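import Summits.HubbardSuperconductivity.HubbardSuperconductivity.Theorems.AnisotropyChordTransferFibre3KT1Targets
import Summits.HubbardSuperconductivity.HubbardSuperconductivity.Theorems.AnisotropyChordTransferFibre3KT2bTargets
import Summits.HubbardSuperconductivity.HubbardSuperconductivity.Theorems.AnisotropyChordTransferFibre3KernelWindow
import Summits.HubbardSuperconductivity.HubbardSuperconductivity.Theorems.AnisotropyChordTransferFibre3RateLemma
import Summits.HubbardSuperconductivity.HubbardSuperconductivity.Theorems.AnisotropyChordTransferFibre3Level2Toolkit

/-!
# Route `AnisotropyChord` / H0 rotor rung: PORT PartN41-C — the KT-2b row (`OffPoleTailAbs`) of the LEVEL-2 certificate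
(piece A, `∀ L ≥ 128`), crude family C

Port (verbatim modulo this header) of the theory seat's statement file `hubbard-h0-rotor-theory-1/cycle22/lean/PartN41C.lean`
(sha16 `d3b59d8f014e40ce`; theory seat `hubbard-h0-rotor-theory-1` g22, REPORT 1 = FINAL 2026-08-30T03:45:31Z and NOTE
04:12:54Z; memo ROTOR-THEORY-22 §338; cycle22/lean/PORT-INDEX.md).  Statements only (`def … : Prop` = TARGETS, plain `def` =
objects; nothing is proved here).  Division (STATUS 03:45Z): §1–§3 proofs p3 lineage, §4 p1 lineage; the row is assembled by
`KT2Assembly.offPoleTailAbs_of_brackets` (…KT2Assembly).  Ported by prover seat `hubbard-h0-rotor-p1` g26;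
`--supports stmt-HubbardSuperconductivity-23918`.  WHAT THIS IS NOT: nothing here proves superconductivity in the Hubbard model.

ORIGINAL MODULE DOCSTRING (theory-1 g22):

# PartN41-C — the KT-2b row (`OffPoleTailAbs`) of the LEVEL-2 certificate of piece A (`∀ L ≥ 128`) with CRUDE family-C
bounds: drops, `R̄` closed, `X` named, `Q₀`/`f_max` crude, `Ψ` semi-closed, the contact-shell sum `Sh` by the shell
cancellation + a gradient sup bound (theory-1 g22, memo 22 §338; LEVEL2-SPEC §3 rows C / f_max / P / cs2 / Ψ / Sh)

STATEMENT FILE (`def … : Prop` = TARGET, plain `def` = object).  The row is `hKT2b` of `gm3_allL_window`, assembled by p1's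
`KT2Assembly.offPoleTailAbs_of_brackets` from SIX brackets `cs2 ≤ Chi`, `‖C0′‖² ≤ Nhi`, `Plo ≤ P`, `Llo ≤ lowN`, `Tlo ≤ T⁺ ≤ Thi`.
This file supplies, for `L ≥ 128`, cell-wise computable `Chi`, `Nhi` and the drops `Plo = Llo = 0`; `Tlo/Thi` come from
PartN41-B `TplusFromPC0`.  MEASURED at `L = 128` (cycle22/calc, memo 22 §335): with every bound of this file in place of the
exact value, `Δ = .1/.5/.95`: `cs2` ×1.04/1.025/1.005, `Ψ` ×1.06/1.06/1.0, `f_max` 1.078/1.062/1.013 (truth 1.067/1.053/1.010),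
`Sh ≤ 2.2/0.9/.002` (truth .0020/.0015/.00001 — crude but cheap), hence `‖R′‖²`-combination ×1.34/1.31/1.10,
and with `P = lowN := 0` the certificate margins are `+.40/+.32/+.35` with `δ = ξ`, `+.38/+.28/+.32` with `δ = GradSupBound`
(Level-1 exact: .47/.42/.45; cycle22/calc/level2_rowC.py).  So the KT-2b row needs NO
named sum beyond `S₂` (B1), `τₓ(K₁)` (PartN41-B `TauNamed`/`TxBracket`), the window values (family A) and two new L-uniform
constants (`GminUniform`, `LamIncrementBound`).  The KT-2a row (`lowG`, 45 low-shell coefficients) is NOT in this file (§6).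
-/

set_option linter.dupNamespace false
set_option autoImplicit false

noncomputable section

open scoped BigOperators
open Complex

namespace Summit.HubbardSuperconductivity.HubbardSuperconductivity.Theorems.AnisotropyChord.Transfer.Fibre3

variable (L : ℕ) [NeZero L]

/-! ## §1 Drops: `P ≥ 0`, `lowN ≥ 0` (take `Plo = Llo = 0`; cost at `L = 128`: margins .47/.42/.45 → .45/.38/.37 exact) -/

/-- `P ≥ 0` (a sum of `normSq/V²`). -/
def PolePartNonneg (Δ : ℝ) : Prop := ∀ f : Tor L → ℝ, 0 ≤ polePart L Δ f

/-- `lowN ≥ 0`. -/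
def LowNormPartNonneg (Δ : ℝ) : Prop := ∀ f : Tor L → ℝ, 0 ≤ lowNormPart L Δ f

/-! ## §2 Inputs of `Cs2RealSpaceBound` in closed / named / crude form -/

/-- `τ̄ := ‖∇ₓ s‖² = Σ_a (s(a) − s(a − x̂))²` (closed on the manifold: PartN41-B `GradSNormClosed`/`tauBar`). -/
def gradNormSq (Δ : ℝ) (f : Tor L → ℝ) : ℝ := ∑ a : Tor L, gradx L (sfun L Δ f) a ^ 2

/-- `τₓ(K₁) := FT[(∇ₓ s)²](K₁)` (named: PartN41-B `TauNamed`, bracketed by `NamedSumBrackets` + `TxBracket`). -/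
def tauK1 (Δ : ℝ) (f : Tor L → ℝ) : ℂ := dft L (fun a => gradx L (sfun L Δ f) a ^ 2) (K1 L)

/-- ★ `R̄ = τ̄ − 2η_eff²` EXACTLY (`∇ₓs(0) = η_eff`, `∇ₓs(x̂) = −η_eff` for the symmetric ground profile, `L ≥ 3`). -/
def RbarClosed (Δ : ℝ) : Prop :=
  ∀ lam2 : ℝ, ∀ f : Tor L → ℝ, 3 ≤ L → IsGroundTwoMagnon L Δ lam2 f →
    Rbar L Δ f = gradNormSq L Δ f - 2 * etaEff L lam2 ^ 2

/-- ★ `X` NAMED: `X = R̄ − Re(e^{iθ} τₓ(K₁)) + η_eff²(1 + cos θ)`. -/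
def XmomNamed (Δ : ℝ) : Prop :=
  ∀ lam2 : ℝ, ∀ f : Tor L → ℝ, 3 ≤ L → IsGroundTwoMagnon L Δ lam2 f →
    Xmom L Δ f = Rbar L Δ f - (phase L (K1 L) (K1 L) * tauK1 L Δ f).re
      + etaEff L lam2 ^ 2 * (1 + Real.cos (2 * Real.pi / L))

/-- `Q₀` EXPANSION in `s = 1 − f` off the origin (`f(0) = 0`, `Σ_{r≠0} s = −1` from `Σ f = V`):
`Q₀ = V + 3 + 6Σ′s² − 4Σ′s³ + Σ′s⁴`, `Σ′ = Σ_{r ≠ 0}`, and `Σ′s² = ‖s‖² − (1 − a)²` (PartN41-B `SNormNamed`). -/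
def Q0Expansion (Δ : ℝ) : Prop :=
  ∀ lam2 : ℝ, ∀ f : Tor L → ℝ, IsTwoMagnon L Δ lam2 f →
    (∑ r ∈ (Finset.univ : Finset (Tor L)).erase 0, sfun L Δ f r) = -1 ∧
    Q0 L f = (L : ℝ) ^ 2 + 3 + 6 * (∑ r ∈ (Finset.univ : Finset (Tor L)).erase 0, sfun L Δ f r ^ 2)
      - 4 * (∑ r ∈ (Finset.univ : Finset (Tor L)).erase 0, sfun L Δ f r ^ 3)
      + (∑ r ∈ (Finset.univ : Finset (Tor L)).erase 0, sfun L Δ f r ^ 4)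

/-- ★ `|s| ≤ σ := 1 − a + 2a/V` off the origin (`a ≤ f ≤ 2 − a + 2a/V` from `f = a + c_s a_λ`, `0 ≤ a_λ ≤ 2G̃(0)`,
`c_s G̃(0) = 1 − a + a/V`), hence the CRUDE `Q₀ ≤ V + 3 + (6 + 4σ + σ²)·Σ′s²` (cost on `cs2` at `L = 128`: ≤ 4 %). -/
def Q0Crude (Δ : ℝ) : Prop :=
  ∀ lam2 : ℝ, ∀ f : Tor L → ℝ, 5 ≤ L → 0 ≤ Δ → Δ < 1 → IsGroundTwoMagnon L Δ lam2 f →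
    let a : ℝ := Δ * f (K1 L)
    let σ : ℝ := 1 - a + 2 * a / (L : ℝ) ^ 2
    (∀ r : Tor L, r ≠ 0 → |sfun L Δ f r| ≤ σ) ∧
    (∀ r : Tor L, f r ≤ 2 - a + 2 * a / (L : ℝ) ^ 2) ∧
    Q0 L f ≤ (L : ℝ) ^ 2 + 3 + (6 + 4 * σ + σ ^ 2) * (∑ r ∈ (Finset.univ : Finset (Tor L)).erase 0, sfun L Δ f r ^ 2)

/-- ★ L-UNIFORM G-MIN CONSTANT (from the landed `geomGMin_holds` with `n₀ = ⌊V/3⌋`: first term `((4/c₀)^{n₀} − 1)/(λV)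
≤ 0.0417 + 0.035ν`, second term `≤ 0.022 + 0.06ν`; evaluated cycle22: `.0632/.0659/.0681` at `ν = 0/.0297/.0513`, identical to
4 digits for `L = 128, 192, 256`; truth `max_r(−G̃) = .0552 + .08ν`): for `L ≥ 128`, `0 < λ₂ ≤ 0.0513θ²`, every `r`,
`−G̃_λ(r) ≤ 0.064 + 0.1ν`. -/
def GminUniform : Prop :=
  ∀ (L : ℕ) [NeZero L], 128 ≤ L → ∀ lam2 : ℝ, 0 < lam2 → lam2 ≤ 0.0513 * (2 * Real.pi / L) ^ 2 →
    ∀ r : Tor L, -Gres L lam2 r ≤ 0.064 + 0.1 * (lam2 / (2 * Real.pi / L) ^ 2)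

/-- ★ `f_max` UNIFORM: `f(r) = a + c_s(G̃(0) − G̃(r)) ≤ 1 + a/V + c_s(0.064 + 0.1ν)` (`L ≥ 128`; 1.078/1.062/1.013 vs truth
1.067/1.053/1.010 at `L = 128`).  This is the `M` fed to `Cs2RealSpaceBound` and `C0FreeBound`. -/
def FmaxUniform : Prop :=
  ∀ (L : ℕ) [NeZero L], 128 ≤ L → ∀ Δ lam2 : ℝ, ∀ f : Tor L → ℝ, 0 ≤ Δ → Δ < 1 → IsGroundTwoMagnon L Δ lam2 f →
    lam2 ≤ 0.0513 * (2 * Real.pi / L) ^ 2 →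
    ∀ r : Tor L, |f r| ≤ 1 + Δ * f (K1 L) / (L : ℝ) ^ 2 + cS L Δ lam2 f * (0.064 + 0.1 * (lam2 / (2 * Real.pi / L) ^ 2))

/-! ## §3 `Ψ` SEMI-CLOSED (×1.06 at `L = 128`): symmetry classes, the diagonal closed, the anti-diagonal by Cauchy–Schwarz,
the cross class by `0 ≤ Σ_a ∇ₓs ∇_y s ≤ ¼‖T₀ s‖²` (AM–GM in Fourier space) minus its contact part -/

/-- the window gradient constants `ξ := c_s(a_λ(2x̂) − a_λ(x̂)) = f(2x̂) − f_nn`, `ζ := c_s(a_λ(x̂+ŷ) − a_λ(x̂)) = f(x̂+ŷ) − f_nn`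
(closed in `(a, ν)` up to the family-A window enclosures PartN41-A `SecondShellWindow`). -/
def xiW (f : Tor L → ℝ) : ℝ := f (ex L + ex L) - f (ex L)

/-- see `xiW`. -/
def zetaW (f : Tor L → ℝ) : ℝ := f (ex L + ey L) - f (ex L)

/-- the contact part of `‖∇ₓ s‖²` on `{0} ∪ NN`: `κ_w = 2η² + ξ² + 2ζ²` (= .2021/.1274/.0047 at `L = 128`, checked). -/
def kapW (lam2 : ℝ) (f : Tor L → ℝ) : ℝ := 2 * etaEff L lam2 ^ 2 + xiW L f ^ 2 + 2 * zetaW L f ^ 2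

/-- the contact part of the cross correlation `Σ_{a ∈ {0}∪NN} ∇ₓs ∇_y s = η² − 2ηζ + 2ξζ`. -/
def crossW (lam2 : ℝ) (f : Tor L → ℝ) : ℝ :=
  etaEff L lam2 ^ 2 - 2 * etaEff L lam2 * zetaW L f + 2 * xiW L f * zetaW L f

/-- `‖T₀ s‖²` with `(T₀ s)(a) = ½Σ_e (s(a) − s(a − e))`; NAMED: `= (c_s²/4V) Σ_{k≠0} (1 + λ₂ g(k))² = (c_s²/4V)(V − 1 + 2λ₂S₁ + λ₂²S₂)`. -/
def lapNormSq (Δ : ℝ) (f : Tor L → ℝ) : ℝ :=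
  ∑ a : Tor L, (((nnList L).map (fun e => sfun L Δ f a - sfun L Δ f (a - e))).sum / 2) ^ 2

/-- `‖T₀ s‖²` named. -/
def LapNormNamed (Δ : ℝ) : Prop :=
  ∀ lam2 : ℝ, ∀ f : Tor L → ℝ, 5 ≤ L → 0 ≤ Δ → Δ < 1 → IsGroundTwoMagnon L Δ lam2 f →
    lapNormSq L Δ f = cS L Δ lam2 f ^ 2 / (4 * (L : ℝ) ^ 2) * ∑ k ∈ (Finset.univ : Finset (Tor L)).erase 0, (1 + lam2 * gres L lam2 k) ^ 2

/-- ★ `Ψ` BY CLASSES (D₄ symmetry of the ground profile): `Ψ = 4ψ_{x,x}² + 4ψ_{x,−x}² + 8ψ_{x,y}²`, with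
`ψ_{x,x} = τ̄ − κ_w`, `|ψ_{x,−x}| ≤ ψ_{x,x}`, `−crossW ≤ ψ_{x,y} ≤ ¼‖T₀s‖² − crossW`; hence
`Ψ ≤ 8(τ̄ − κ_w)² + 8·max(crossW, ¼‖T₀s‖² − crossW)²` (1.112/.439/.0006 vs truth 1.051/.415/.0006 at `L = 128`). -/
def PsiSemiClosed (Δ : ℝ) : Prop :=
  ∀ lam2 : ℝ, ∀ f : Tor L → ℝ, 5 ≤ L → 0 ≤ Δ → Δ < 1 → IsGroundTwoMagnon L Δ lam2 f →
    PsiSum L Δ f = 4 * psiCorr L Δ f (ex L) (ex L) ^ 2 + 4 * psiCorr L Δ f (ex L) (-ex L) ^ 2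
        + 8 * psiCorr L Δ f (ex L) (ey L) ^ 2 ∧
    psiCorr L Δ f (ex L) (ex L) = gradNormSq L Δ f - kapW L lam2 f ∧
    |psiCorr L Δ f (ex L) (-ex L)| ≤ psiCorr L Δ f (ex L) (ex L) ∧
    -crossW L lam2 f ≤ psiCorr L Δ f (ex L) (ey L) ∧
    psiCorr L Δ f (ex L) (ey L) ≤ lapNormSq L Δ f / 4 - crossW L lam2 f ∧
    PsiSum L Δ f ≤ 8 * (gradNormSq L Δ f - kapW L lam2 f) ^ 2
      + 8 * (max (crossW L lam2 f) (lapNormSq L Δ f / 4 - crossW L lam2 f)) ^ 2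

/-! ## §4 The contact-shell sum `Sh := ‖C0‖² − ‖C0‖²_{W=0}`: permutation symmetry → one class; the SHELL CANCELLATION
`f(c)D_{e₀}f(e₀)D_{e₀}f(b) + f(b)D_{−(−e₀)}… = −f(e₀)(D_{e₀}f(b))²`; a gradient sup bound from the SUBADDITIVITY of `a₀`;
Cauchy–Schwarz bookkeeping.  Crude (bound/truth ≈ 10³) but its weight is small: `Sh⁺ ≤ 3.0/1.6/.005` (`δ = GradSupBound`) keeps margins ≥ +.28. -/

open Classical in
/-- `Sh := Σ_{W ≥ 1} C0²` (`C0fn` vanishes on `D`). -/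
def nC0shell (Δ lam2 : ℝ) (f : Tor L → ℝ) : ℝ :=
  ∑ c ∈ Finset.univ.filter (fun c : Cfg L => Wcount L c ≠ 0), C0fn L Δ lam2 f c ^ 2

/-- `‖C0‖² = ‖C0‖²_{W=0} + Sh` and `‖C0′‖² ≤ ‖C0‖²` (`C0PrimePythagoras`), so `Nhi := (9/4)M²Ψ⁺ + Sh⁺` is admissible. -/
def NC0Split (Δ : ℝ) : Prop :=
  ∀ lam2 : ℝ, ∀ f : Tor L → ℝ, IsTwoMagnon L Δ lam2 f →
    nC0 L Δ lam2 f = nC0free L Δ lam2 f + nC0shell L Δ lam2 f ∧ nC0p L Δ f ≤ nC0 L Δ lam2 f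

/-- PERMUTATION INVARIANCE of `C0` (relabel the three particles): `C0(b,a) = C0(a,b) = C0(−a, b−a)`. -/
def C0PermInvariant (Δ : ℝ) : Prop :=
  ∀ lam2 : ℝ, ∀ f : Tor L → ℝ, IsTwoMagnon L Δ lam2 f → (∀ r : Tor L, f (-r) = f r) → ∀ a b : Tor L,
    C0fn L Δ lam2 f (b, a) = C0fn L Δ lam2 f (a, b) ∧ C0fn L Δ lam2 f (-a, b - a) = C0fn L Δ lam2 f (a, b)

/-- ★ SHELL → ONE CLASS (union bound over the three pairs + permutation invariance + D₄): `Sh ≤ 12·Σ_{b ∉ {0,x̂}} C0(x̂, b)²`. -/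
def ShellReduction (Δ : ℝ) : Prop :=
  ∀ lam2 : ℝ, ∀ f : Tor L → ℝ, IsGroundTwoMagnon L Δ lam2 f → (∀ r : Tor L, f (r.2, r.1) = f r) →
    (∀ r : Tor L, f (-r.1, r.2) = f r) →
    nC0shell L Δ lam2 f ≤ 12 * ∑ b ∈ ((Finset.univ : Finset (Tor L)).erase 0).erase (ex L), C0fn L Δ lam2 f (ex L, b) ^ 2

/-- ★ THE SHELL CANCELLATION (from `C0Explicit` at `a = x̂`, `c = b − x̂`: the two terms carrying the hard-core jump
`D_{x̂}f(x̂) = D_{−x̂}^{←}f(x̂) = f(x̂)` combine to `−f(x̂)(D_{x̂}f(b))²`):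
`C0(x̂,b) = ½f_nn(D_{x̂}f(b))² − ½f_nn Σ_e D_e f(b)D_e f(c) − ½Σ_e [f(c)·ω_e·D_e f(b) + f(b)·ω′_e·D_e f(c)]`,
`ω_e := D_e f(x̂) − [e = x̂]f_nn ∈ {0, −ξ, −ζ, −ζ}`, `ω′_e := D^{(+e)} f(x̂) − [e = −x̂]f_nn ∈ {−ξ, 0, −ζ, −ζ}`. -/
def C0ShellForm (Δ : ℝ) : Prop :=
  ∀ lam2 : ℝ, ∀ f : Tor L → ℝ, IsTwoMagnon L Δ lam2 f → ∀ b : Tor L, b ≠ 0 → b ≠ ex L →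
    C0fn L Δ lam2 f (ex L, b)
      = f (ex L) / 2 * Dgrad L f (ex L) b ^ 2
        - f (ex L) / 2 * ((nnList L).map (fun e => Dgrad L f e b * Dgrad L f e (b - ex L))).sum
        - (1 / 2 : ℝ) * ((nnList L).map (fun e =>
            f (b - ex L) * (Dgrad L f e (ex L) - if e = ex L then f (ex L) else 0) * Dgrad L f e b
            + f b * (f (ex L) - f (ex L + e) - if e = -ex L then f (ex L) else 0) * Dgrad L f e (b - ex L))).sum

/-- ★ SUBADDITIVITY of the `λ = 0` torus kernel: `a₀(r + r′) ≤ a₀(r) + a₀(r′)` (killed-walk Green function `(2T₀ + μ)⁻¹`,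
`μ ↓ 0`: `1 − G(x,y)/G(0)` is the probability of NOT hitting `y` before killing, sub-additive by the strong Markov property;
the zero mode cancels in differences and `a_μ → a₀`).  Corollary: `|a₀(b) − a₀(b − e)| ≤ a₀(e) = (1 − 1/V)/4` (`aKer_zero_axis`). -/
def KernelSubadditive : Prop :=
  ∀ r r' : Tor L, aKer L 0 (r + r') ≤ aKer L 0 r + aKer L 0 r'

/-- ★ λ-INCREMENT BOUND: `|δ_λ(b) − δ_λ(b − e)| ≤ (λ/V)Σ_{k≠0} √(2(1 − cos k·e))/(2ε(2ε − λ)) ≤ 0.001` for `L ≥ 128`,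
`0 ≤ λ₂ ≤ 0.0513θ²`, `e ∈ NN` (the sum is `≈ (ν/2π√V)·Σ_p |p₁|/|p|⁴ ≈ 3·10⁻⁴` at `L = 128` and decreases like `1/L`). -/
def LamIncrementBound : Prop :=
  ∀ (L : ℕ) [NeZero L], 128 ≤ L → ∀ lam2 : ℝ, 0 ≤ lam2 → lam2 ≤ 0.0513 * (2 * Real.pi / L) ^ 2 →
    ∀ e ∈ nnList L, ∀ b : Tor L, |RateLemma.lamPart L lam2 b - RateLemma.lamPart L lam2 (b - e)| ≤ 0.001

/-- ★ GRADIENT SUP BOUND off the origin: `|f(b) − f(b − e)| = c_s|a_λ(b) − a_λ(b−e)| ≤ c_s(a₀(e) + 0.001) ≤ η_eff + 0.001c_s`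
(`c_s a_λ(x̂) = η_eff`, `a₀ ≤ a_λ`); measured sup = `ξ` = .133/.106/.020 vs `η` = .293/.233/.045 at `L = 128`. -/
def GradSupBound : Prop :=
  ∀ (L : ℕ) [NeZero L], 128 ≤ L → ∀ Δ lam2 : ℝ, ∀ f : Tor L → ℝ, 0 ≤ Δ → Δ < 1 → IsGroundTwoMagnon L Δ lam2 f →
    lam2 ≤ 0.0513 * (2 * Real.pi / L) ^ 2 →
    ∀ e ∈ nnList L, ∀ b : Tor L, b ≠ 0 → b - e ≠ 0 →
      |Dgrad L f e b| ≤ etaEff L lam2 + 0.001 * cS L Δ lam2 f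

/-- the six window sites `b ∈ {−x̂, ±ŷ, 2x̂, x̂ ± ŷ}` where a gradient in `C0ShellForm` meets the origin (there `C0(x̂,b)²` is
evaluated in CLOSED form from window values `|r|∞ ≤ 3`, family A). -/
def shellWin : Finset (Tor L) :=
  {-ex L, ey L, -ey L, ex L + ex L, ex L + ey L, ex L - ey L}

/-- ★ THE CRUDE SHELL BOUND (Cauchy–Schwarz on `C0ShellForm` off `shellWin`, `|f| ≤ M`, `|D f| ≤ δ` off the origin,
`Σ_b ρ(b)ρ(b − x̂) ≤ sup ρ · Σρ` with `ρ = Σ_e (D_e f)² ≤ 4δ²`):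
`Σ_{b ∉ shellWin ∪ {0,x̂}} C0(x̂,b)² ≤ (17 f_nn² δ² + 8ξ²M² + 16ζ²M²)·τ̄`
(off `shellWin ∪ {0,x̂}` every gradient in `C0ShellForm` has both endpoints `≠ 0`, so it is a gradient of `s` and its square-sums
are `≤ τ̄ = ‖∇s‖²` — NOT `‖∇f‖²`, which carries the hard-core jump `2f_nn²` and would ruin `Δ → 1`; measured cycle22
`level2_rowC.py`: with `δ = ξ` the bound is ≈ 10³ × truth but `Sh⁺ ≤ 2.2/.9/.002` costs only margins .45/.38/.37 → .40/.32/.35;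
with `δ := GradSupBound = η + .001c_s` (`Sh⁺ ≤ 3.0/1.6/.005`) → .38/.28/.32; the sharper `δ = ξ⁺` needs `|∇a_λ| ≤ a_λ(2x̂) − a_λ(x̂)` off the window —
OPEN, numerically true). -/
def ShellBulkBound (Δ : ℝ) : Prop :=
  ∀ lam2 M δ : ℝ, ∀ f : Tor L → ℝ, IsTwoMagnon L Δ lam2 f → (∀ r : Tor L, f (-r) = f r) →
    (∀ r : Tor L, f (r.2, r.1) = f r) → (∀ r : Tor L, f (-r.1, r.2) = f r) →
    (∀ r : Tor L, |f r| ≤ M) → (∀ e ∈ nnList L, ∀ b : Tor L, b ≠ 0 → b - e ≠ 0 → |Dgrad L f e b| ≤ δ) → 0 ≤ δ →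
    (∑ b ∈ (((Finset.univ : Finset (Tor L)).erase 0).erase (ex L)) \ shellWin L, C0fn L Δ lam2 f (ex L, b) ^ 2)
      ≤ (17 * f (ex L) ^ 2 * δ ^ 2 + 8 * xiW L f ^ 2 * M ^ 2 + 16 * zetaW L f ^ 2 * M ^ 2) * gradNormSq L Δ f

/-- ★ ROW ASSEMBLY for `Nhi`: `‖C0′‖² ≤ (9/4)M²Ψ⁺ + 12·(Σ_{b ∈ shellWin} C0(x̂,b)² + bulk⁺)`. -/
def NC0Row (Δ : ℝ) : Prop :=
  ∀ lam2 M δ : ℝ, ∀ f : Tor L → ℝ, IsGroundTwoMagnon L Δ lam2 f → (∀ r : Tor L, f (r.2, r.1) = f r) →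
    (∀ r : Tor L, f (-r.1, r.2) = f r) → (∀ r : Tor L, |f r| ≤ M) →
    (∀ e ∈ nnList L, ∀ b : Tor L, b ≠ 0 → b - e ≠ 0 → |Dgrad L f e b| ≤ δ) → 0 ≤ δ →
    nC0p L Δ f ≤ 9 / 4 * M ^ 2 * PsiSum L Δ f
      + 12 * ((∑ b ∈ shellWin L, C0fn L Δ lam2 f (ex L, b) ^ 2)
        + (17 * f (ex L) ^ 2 * δ ^ 2 + 8 * xiW L f ^ 2 * M ^ 2 + 16 * zetaW L f ^ 2 * M ^ 2) * gradNormSq L Δ f)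

/-! ## §5 How the row is fed to `KT2Assembly.offPoleTailAbs_of_brackets` (cell evaluator, LEVEL2-SPEC item 5)

On a cell `(θ ≤ 2π/128, ν ∈ [ν⁻,ν⁺], a ∈ [a⁻,a⁺])`: `Chi :=` RHS of `Cs2RealSpaceBound` with `M := FmaxUniform`,
`Q₀ := Q0Crude`, `X := XmomNamed` (brackets of `τ̄` closed, `τₓ(K₁)` from PartN41-B), `R̄ := RbarClosed`, `Γ_M` by definition;
`Nhi := NC0Row` with `Ψ⁺ := PsiSemiClosed`, `δ := GradSupBound`, window `C0²` closed; `Plo := 0`, `Llo := 0`;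
`Tlo, Thi :=` PartN41-B `TplusFromPC0`; then `b :=` the smallest number with
`(3√Chi + 3√Nhi)² ≤ b·(L²λ₂/4)(2ε₁ − Thi)(3V²Tlo)` on the cell (monotone corners), and `regime_of_brackets` checks
`fac⁺·η⁺·(a + b/ρ⁻) < c` with `a` from the KT-2a row (§6) and `c` from PartN41-B/`KT1Assembly`.

## §6 NOT IN THIS FILE — see PartN41D.lean: the KT-2a row `lowG ≤ a·η_eff·U`

`lowG = Σ_{45 low (k₂,k₃)} |R̂′(k)|²/(V² den)` (`PartN41D.LowGRowForm`), budget ×5 (`a″ ≈ .037`, may reach `.19` at `L = 128`).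
★ EVALUATE `R̂′` ONLY through `PartN41D` §3 `RhatCancelled` (R′ = v·C0′ + M off D, profile split f = f_JU + f_S, the pure-jump
monomial ≡ 0, seven monomials = one-loop convolutions of split profiles; §4 `ConvExpansion` → primitives `Eprim r S`; §5 `BoundaryLines`):
adding moduli of the monomials costs ×1.1–1.5 on `a″`.  The termwise one-loop form (`PartN41D` §2 `RhatOneLoop`: `den·Ψ̂¹ − Δ·FTW + B_d`)
is TRUE but its pieces cancel ×82–36290 (rowD_cancellation.out) — never bound it termwise.  `lowG` cannot be dropped or merged into the
KT-2b budget (`lowG ≤ lowN/(2ε₁ − T⁺)` costs `+.47` at `Δ = .1`, margin < 0). -/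

end Summit.HubbardSuperconductivity.HubbardSuperconductivity.Theorems.AnisotropyChord.Transfer.Fibre3

end
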